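import Summits.AtomisticToContinuum.Crystallization.Theorems.FrustratedLawDichotomyStrainedPatchHomFloorHcpZone
import Summits.AtomisticToContinuum.Crystallization.Theorems.FrustratedLawDichotomyStrainedPatchHomSignedWellKappa

/-!
# Aperiodic strained patch — «HomNearSocketKappa»: the κ-form of the near `U`-box entry (cell decomp-a2c hand-2 g44, structural #48; DEF-FREE)

hand-1 g48 «KappaSocket» (`…HomSignedWell.hcpEnergy_of_ballLeaves_kappa`, critic row 1666 (C) «D-KAPPA») replaces the diameter factor `5/4` of (144)
`hcpEnergy_of_ballLeaves_signed` by any operator bound `κ` with `‖U v‖ ≤ κ‖v‖` on the box (`κ = 5/4` recovers (144); the near frames read `κ ≈ 1.00`, i.e.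
slope charge ×0.80 and curvature charge ×0.64).  This file is #47's chain with that leaf: the `hNear B` binder of #44 `homFloorHcp_of_dispatch[_graded]` from the
κ-bound, the three ζ-centred leaves at the record window and the budget line `2(m + e_W) ≤ V₀ − G·(κR₀) + (min λ 0/2)(κR₀)²` — general frame
(`homFloorHcp_leafBall_of_ballLeaves_kappa`) and polar-factor form (`…_selfAdjoint`).  Proofs = #47's with `hκ` threaded; 0 sorry; no definitions; standard axioms.
`--supports stmt-AtomisticToContinuum-27623 --as helper`.  [folklore chaining]
-/

noncomputable section

namespace Summit.AtomisticToContinuum.Crystallization.Theorems.FrustratedLawDichotomyStrainedPatchHomNearSocketKappa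

open scoped BigOperators
open Summit.AtomisticToContinuum.Crystallization.Theorems.ChargedEnergyGapNegative (E3)
open Summit.AtomisticToContinuum.Crystallization.Theorems.FrustratedLawDichotomySchurCut (effPot w₄₅ ω₄)
open Summit.AtomisticToContinuum.Crystallization.Theorems.FrustratedLawDichotomyStrainedPatchTaylorChord (segR segG segGd)
open Summit.AtomisticToContinuum.Crystallization.Theorems.FrustratedLawDichotomyStrainedPatchHomSplit (latPt hexFrame hcpShift)
open Summit.AtomisticToContinuum.Crystallization.Theorems.FrustratedLawDichotomyStrainedPatchTaylorLeaves (junctions)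
open Summit.AtomisticToContinuum.Crystallization.Theorems.FrustratedLawDichotomyStrainedPatchHomXiWindow (HomFloorHcp)
open Summit.AtomisticToContinuum.Crystallization.Theorems.FrustratedLawDichotomyStrainedPatchHomSignedWell (hcpEnergy_of_ballLeaves_kappa)
open Summit.AtomisticToContinuum.Crystallization.Theorems.FrustratedLawDichotomyStrainedPatchHomFloorHcpZone

/-! ## §1. The κ-form near socket, general frame -/

section General

variable {box : (E3 →L[ℝ] E3) → Prop} {σ : (E3 →L[ℝ] E3) → E3} {R₀ lam G V₀ m κ : ℝ}

/-- ★★★ **NEAR `U`-BOX ENTRY WITH THE κ-CREDIT** (hand-1 g48 «KappaSocket», critic row 1666 (C) D-KAPPA): an operator-norm bound `‖U v‖ ≤ κ‖v‖` on the box (hand-1 `norm_apply_le_opHiJ`, κ ≈ 1.00 near) and the three ζ-centred leaves of `hcpEnergy_of_ballLeaves_kappa` at the RECORD window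
`[−7,7]³` with the `A`-family term the unshifted filtered sum, the track inside the quarter ball on the box, and the budget line
`2(m + e_W) ≤ V₀ − G·(κR₀) + (min λ 0/2)(κR₀)²` (slope charge ×κ/(5/4), curvature ×(κ/(5/4))²) ⟹ the `hNear` binder `HomFloorHcp (box G ∧ ‖ξ − σ G‖ ≤ R₀) m` of #44's dispatch.
[folklore chaining: «KappaSocket» `hcpEnergy_of_ballLeaves_kappa` + #46 `homFloorHcp_leafBall_of_boxSum`] -/
theorem homFloorHcp_leafBall_of_ballLeaves_kappa (hG₀ : 0 ≤ G)
    (hκ : ∀ U : E3 →L[ℝ] E3, box U → ∀ v : E3, ‖U v‖ ≤ κ * ‖v‖)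
    (hσ : ∀ U : E3 →L[ℝ] E3, box U → ‖U - 1‖ ≤ 1 / 4 → ‖σ U‖ ≤ 1 / 4)
    (hval : ∀ U : E3 →L[ℝ] E3, box U → ‖U - 1‖ ≤ 1 / 4 → ‖σ U‖ ≤ 1 / 4 →
      V₀ ≤ (∑ b ∈ (Fintype.piFinset fun _ : Fin 3 => Finset.Icc (-7 : ℤ) 7).filter (fun b => b ≠ 0), effPot w₄₅ ω₄ (3 / 400) ‖latPt U hexFrame b‖) +
        ∑ b ∈ (Fintype.piFinset fun _ : Fin 3 => Finset.Icc (-7 : ℤ) 7), effPot w₄₅ ω₄ (3 / 400) ‖latPt U hexFrame b + U (hcpShift + σ U)‖)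
    (hslope : ∀ (U : E3 →L[ℝ] E3) (ξ : E3), box U → ‖U - 1‖ ≤ 1 / 4 → ‖σ U‖ ≤ 1 / 4 →
      |∑ b ∈ (Fintype.piFinset fun _ : Fin 3 => Finset.Icc (-7 : ℤ) 7),
          segG (deriv (effPot w₄₅ ω₄ (3 / 400))) (latPt U hexFrame b + U (hcpShift + σ U)) (U (ξ - σ U)) 0| ≤ G * ‖U (ξ - σ U)‖)
    (hcurv : ∀ (U : E3 →L[ℝ] E3) (ξ : E3), box U → ‖U - 1‖ ≤ 1 / 4 → ‖σ U‖ ≤ 1 / 4 → ‖ξ - σ U‖ ≤ R₀ → ‖ξ‖ ≤ 1 / 4 →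
      ∀ s ∈ Set.Ioo (0 : ℝ) 1, (∀ b ∈ (Fintype.piFinset fun _ : Fin 3 => Finset.Icc (-7 : ℤ) 7),
          segR (latPt U hexFrame b + U (hcpShift + σ U)) (U (ξ - σ U)) s ∉ junctions) →
        lam * ‖U (ξ - σ U)‖ ^ 2 ≤ ∑ b ∈ (Fintype.piFinset fun _ : Fin 3 => Finset.Icc (-7 : ℤ) 7),
          segGd (deriv (effPot w₄₅ ω₄ (3 / 400))) (latPt U hexFrame b + U (hcpShift + σ U)) (U (ξ - σ U)) s)
    (hm : 2 * (m + (-(7175 / 10000) + 3 / 400)) ≤ V₀ - G * (κ * R₀) + min lam 0 / 2 * (κ * R₀) ^ 2) :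
    HomFloorHcp (fun G ξ => box G ∧ ‖ξ - σ G‖ ≤ R₀) m := by
  refine homFloorHcp_leafBall_of_boxSum fun U ξ hU hξ hB hr => ?_
  have key := hcpEnergy_of_ballLeaves_kappa (Fintype.piFinset fun _ : Fin 3 => Finset.Icc (-7 : ℤ) 7) box σ hG₀
    (fun U => ∑ b ∈ (Fintype.piFinset fun _ : Fin 3 => Finset.Icc (-7 : ℤ) 7).filter (fun b => b ≠ 0), effPot w₄₅ ω₄ (3 / 400) ‖latPt U hexFrame b‖)
    hκ hval hslope hcurv U hB hU (hσ U hB hU) ξ hr hξ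
  linarith

end General

/-! ## §2. The κ-form near socket, polar-factor form -/

section Polar

variable {box : (E3 →L[ℝ] E3) → Prop} {σ : (E3 →L[ℝ] E3) → E3} {R₀ lam G V₀ m κ : ℝ}

/-- ★★★ **κ-FORM, LEAVES ON SELF-ADJOINT `U` ONLY** (sym-entry `U`-boxes): `box` and `σ` rotation-invariant, the three leaves certified for every
self-adjoint positive `U` with `‖U − 1‖ ≤ 1/4` in the box, the budget line ⟹ the `hNear` binder. [folklore chaining: «KappaSocket» + #46 `homFloorHcp_leafBall_of_boxSum_selfAdjoint`] -/
theorem homFloorHcp_leafBall_of_ballLeaves_kappa_selfAdjoint (hG₀ : 0 ≤ G)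
    (hκ : ∀ U : E3 →L[ℝ] E3, (∀ v w : E3, inner ℝ (U v) w = inner ℝ v (U w)) → (∀ w : E3, 0 ≤ inner ℝ w (U w)) → box U →
      ∀ v : E3, ‖U v‖ ≤ κ * ‖v‖)
    (hbox : ∀ (R : E3 ≃ₗᵢ[ℝ] E3) (U : E3 →L[ℝ] E3), box ((R : E3 →L[ℝ] E3).comp U) → box U)
    (hσR : ∀ (R : E3 ≃ₗᵢ[ℝ] E3) (U : E3 →L[ℝ] E3), σ ((R : E3 →L[ℝ] E3).comp U) = σ U)
    (hσ : ∀ U : E3 →L[ℝ] E3, (∀ v w : E3, inner ℝ (U v) w = inner ℝ v (U w)) → (∀ w : E3, 0 ≤ inner ℝ w (U w)) → box U → ‖U - 1‖ ≤ 1 / 4 →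
      ‖σ U‖ ≤ 1 / 4)
    (hval : ∀ U : E3 →L[ℝ] E3, (∀ v w : E3, inner ℝ (U v) w = inner ℝ v (U w)) → (∀ w : E3, 0 ≤ inner ℝ w (U w)) → box U → ‖U - 1‖ ≤ 1 / 4 →
      ‖σ U‖ ≤ 1 / 4 →
      V₀ ≤ (∑ b ∈ (Fintype.piFinset fun _ : Fin 3 => Finset.Icc (-7 : ℤ) 7).filter (fun b => b ≠ 0), effPot w₄₅ ω₄ (3 / 400) ‖latPt U hexFrame b‖) +
        ∑ b ∈ (Fintype.piFinset fun _ : Fin 3 => Finset.Icc (-7 : ℤ) 7), effPot w₄₅ ω₄ (3 / 400) ‖latPt U hexFrame b + U (hcpShift + σ U)‖)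
    (hslope : ∀ (U : E3 →L[ℝ] E3) (ξ : E3), (∀ v w : E3, inner ℝ (U v) w = inner ℝ v (U w)) → (∀ w : E3, 0 ≤ inner ℝ w (U w)) → box U →
      ‖U - 1‖ ≤ 1 / 4 → ‖σ U‖ ≤ 1 / 4 →
      |∑ b ∈ (Fintype.piFinset fun _ : Fin 3 => Finset.Icc (-7 : ℤ) 7),
          segG (deriv (effPot w₄₅ ω₄ (3 / 400))) (latPt U hexFrame b + U (hcpShift + σ U)) (U (ξ - σ U)) 0| ≤ G * ‖U (ξ - σ U)‖)
    (hcurv : ∀ (U : E3 →L[ℝ] E3) (ξ : E3), (∀ v w : E3, inner ℝ (U v) w = inner ℝ v (U w)) → (∀ w : E3, 0 ≤ inner ℝ w (U w)) → box U →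
      ‖U - 1‖ ≤ 1 / 4 → ‖σ U‖ ≤ 1 / 4 → ‖ξ - σ U‖ ≤ R₀ → ‖ξ‖ ≤ 1 / 4 →
      ∀ s ∈ Set.Ioo (0 : ℝ) 1, (∀ b ∈ (Fintype.piFinset fun _ : Fin 3 => Finset.Icc (-7 : ℤ) 7),
          segR (latPt U hexFrame b + U (hcpShift + σ U)) (U (ξ - σ U)) s ∉ junctions) →
        lam * ‖U (ξ - σ U)‖ ^ 2 ≤ ∑ b ∈ (Fintype.piFinset fun _ : Fin 3 => Finset.Icc (-7 : ℤ) 7),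
          segGd (deriv (effPot w₄₅ ω₄ (3 / 400))) (latPt U hexFrame b + U (hcpShift + σ U)) (U (ξ - σ U)) s)
    (hm : 2 * (m + (-(7175 / 10000) + 3 / 400)) ≤ V₀ - G * (κ * R₀) + min lam 0 / 2 * (κ * R₀) ^ 2) :
    HomFloorHcp (fun G ξ => box G ∧ ‖ξ - σ G‖ ≤ R₀) m := by
  refine homFloorHcp_leafBall_of_boxSum_selfAdjoint hbox hσR fun U ξ hsa hpos hU hξ hB hr => ?_
  -- the three leaves restricted to this self-adjoint `U`, packaged for `hcpEnergy_of_ballLeaves_kappa` on the one-point box `{U}`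
  have key := hcpEnergy_of_ballLeaves_kappa (Fintype.piFinset fun _ : Fin 3 => Finset.Icc (-7 : ℤ) 7) (fun U' => U' = U) σ hG₀
    (fun U => ∑ b ∈ (Fintype.piFinset fun _ : Fin 3 => Finset.Icc (-7 : ℤ) 7).filter (fun b => b ≠ 0), effPot w₄₅ ω₄ (3 / 400) ‖latPt U hexFrame b‖)
    (fun U' hU' => by subst hU'; exact hκ U' hsa hpos hB)
    (fun U' hU' hU1 hσ1 => by subst hU'; exact hval U' hsa hpos hB hU1 hσ1)
    (fun U' ξ' hU' hU1 hσ1 => by subst hU'; exact hslope U' ξ' hsa hpos hB hU1 hσ1)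
    (fun U' ξ' hU' hU1 hσ1 hr' hξ' => by subst hU'; exact hcurv U' ξ' hsa hpos hB hU1 hσ1 hr' hξ')
    U rfl hU (hσ U hsa hpos hB hU) ξ hr hξ
  linarith

end Polar

/-! ## §3. The budget line with the κ-credit at the record numbers -/

/-- At `m = 3/5000 + 13/50000`, `R₀ = 3/400`, `κ = 1` (near frames): the same leaves `V₀ = −1.4170`, `λ = −231/200` now tolerate `G = 7/125 = 0.056 > 9/200`. [arithmetic] -/
example : 2 * ((3 / 5000 + 13 / 50000 : ℝ) + (-(7175 / 10000) + 3 / 400)) ≤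
    (-14170 / 10000 : ℝ) - (7 / 125) * (1 * (3 / 400)) + min (-(231 / 200 : ℝ)) 0 / 2 * (1 * (3 / 400)) ^ 2 := by
  rw [min_eq_left (by norm_num)]; norm_num

end Summit.AtomisticToContinuum.Crystallization.Theorems.FrustratedLawDichotomyStrainedPatchHomNearSocketKappa

end
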